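import Literature.Probability.RandomPlanarGeometry.SLETraceEightAssembly
import Literature.Probability.RandomPlanarGeometry.SLEScaleInvariance
import Literature.Probability.RandomPlanarGeometry.SLERestrictionMartingale
import HarnessLib

/-!
# Stability of "SLE_κ is generated by a curve" under limits in `κ` (the Ambrosio–Miller step)

Topic `Probability/RandomPlanarGeometry`; theorems only (no new named fact). The predicate
`Literature.Probability.RandomPlanarGeometry.HasSLETrace κ` (`SLE.lean`: for
`preWienerMeasure`-a.e. `ω` the chordal Loewner chain of `√κ B(ω)` is generated by a curve) is
known for every `κ` by two theorems of very different nature: Rohde–Schramm, Ann. Math. 161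
(2005), Thm. 5.1 for `κ ≠ 8` (named fact `hasSLETrace_of_ne_eight`, resting on the derivative
estimate Cor. 3.5, `RohdeSchramm2005_cor35`) and Lawler–Schramm–Werner, Ann. Probab. 32 (2004),
Thm. 4.7 for `κ = 8` (named fact `hasSLETrace_eight`, resting on the uniform spanning tree
scaling limit, `USTPeano.prop45` / `USTPeano.drivingProcess_tendsto`).

V. Ambrosio and J. Miller, *A continuous proof of the existence of the SLE₈ curve*,
arXiv:2203.13805 (2022), gave a second proof of the `κ = 8` case which "does not build on the
discrete uniform spanning tree scaling limit of Lawler–Schramm–Werner" (abstract): their Thm. 1.1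
is a compactness statement for the laws of SLE_κ curves as `κ` varies in `[4 + ν, 8)`, and
Thm. 1.2 ("Chordal SLE₈ is a.s. generated by a continuous curve") follows in §6 by "tak[ing] a
subsequential limit as `κ ↑ 8`. We will show that after conformally mapping to `ℍ` and
reparameterizing by half-plane capacity the resulting curve has a continuous Loewner driving
function which is given by `√8 B`, `B` a standard Brownian motion, hence is SLE₈" (p. 3).

This file PROVES that limit step in the chordal half-plane-capacity setting of this library, for
every limit value `κ` (`Literature.Probability.RandomPlanarGeometry.hasSLETrace_of_tendsto_of_isTightMeasureSet`):
**if `κₙ → κ`, each SLE_{κₙ} is a.s. generated by a curve, and the laws of the SLE_{κₙ} traces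
(capacity parametrisation, random elements of `C([0, ∞), ℂ)`) form a tight family, then SLE_κ is
a.s. generated by a curve.** The proof is the tree's abstract form of the [LSW04] p. 981 limit
argument (`hasSLETrace_of_tendstoInDistribution`: Prokhorov, closedness of the set of generated
pairs = chordal Lemma 3.14, portmanteau, Lusin–Souslin identification), fed with the SLE_{κₙ}
traces themselves on the canonical space and with the sure locally uniform convergence
`√κₙ B → √κ B` of the driving paths. A Prop. 4.5-shaped uniform modulus-of-continuity bound is a
sufficient form of the tightness hypothesis (`hasSLETrace_of_tendsto_of_modulus`, Arzelà–Ascoli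
via `isTightMeasureSet_of_prop45_shape`), and with `κₙ → 8`, `κₙ ≠ 8` this yields a second
decomposition of the named fact `hasSLETrace_eight`: Rohde–Schramm's theorem plus a uniform (in
`κ` near `8`) modulus estimate for the capacity-parametrised SLE_κ traces
(`hasSLETrace_eight_of_ne_eight_of_modulus`). (Ambrosio–Miller obtain their compactness in the
Lebesgue-measure parametrisation of whole-plane space-filling SLE_κ through imaginary geometry and
reparametrise in §6; the capacity-parametrised tightness assumed here is the input their §6
produces, not their Thm. 1.1 verbatim.)

On the way: the event "the chain of `√κ B` is generated by a curve" is measurable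
(`measurableSet_setOf_exists_isGeneratedByCurve`, from the Borel set of good driving paths
`measurableSet_snd_image_generatedPairs`), hence the SLE_κ trace is an (everywhere defined,
unconditionally) measurable random continuous path (`measurable_sleTrace`,
`measurable_sleTracePath`) — strengthening `aemeasurable_sleTrace_holds` / `aemeasurable_sleTrace_pi`,
which assume `HasSLETrace κ`.

## References

* V. Ambrosio, J. Miller, *A continuous proof of the existence of the SLE₈ curve*,
  arXiv:2203.13805 (2022), Thms. 1.1, 1.2, §6.
* G. F. Lawler, O. Schramm, W. Werner, *Conformal invariance of planar loop-erased random walks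
  and uniform spanning trees*, Ann. Probab. 32 (2004), proof of Thm. 4.7 (p. 981), Lemma 3.14.
* S. Rohde, O. Schramm, *Basic properties of SLE*, Ann. of Math. 161 (2005), Thm. 5.1.
* P. Billingsley, *Convergence of Probability Measures* (2nd ed. 1999), Thms. 2.1, 5.1, 7.3.
-/

noncomputable section

open Set Filter Topology MeasureTheory ProbabilityTheory
open scoped NNReal ENNReal

namespace Literature.Probability.RandomPlanarGeometry

open scoped PathBorel

/-! ### Measurability of the generation event and of the trace -/

section Measurable

variable (κ : ℝ≥0)

/-- **The event "the Loewner chain of `√κ B(ω)` is generated by a curve" is measurable** on the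
canonical space: it is the preimage under the (Borel measurable) driving path
`ω ↦ √κ B(ω) ∈ C([0, ∞), ℝ)` of the set of continuous driving functions generated by a curve,
which is Borel as the injective projection of the closed set `generatedPairs`
(`measurableSet_snd_image_generatedPairs`, Lusin–Souslin, Kechris (1995), Thm. 15.1, on top of
the closedness given by [LSW04] Lemma 3.14). [folklore] -/
theorem measurableSet_setOf_exists_isGeneratedByCurve :
    MeasurableSet {ω : ℝ≥0 → ℝ | ∃ γ, Loewner.IsGeneratedByCurve (sleDriving κ ω) γ} := by
  have h : {ω : ℝ≥0 → ℝ | ∃ γ, Loewner.IsGeneratedByCurve (sleDriving κ ω) γ} =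
      drivingPath κ ⁻¹' (Prod.snd '' generatedPairs) := by
    ext ω
    simp only [mem_setOf_eq, mem_preimage, mem_image, Prod.exists, exists_eq_right,
      mem_generatedPairs, coe_drivingPath]
    constructor
    · rintro ⟨γ, hγ⟩
      exact ⟨⟨γ, hγ.continuous⟩, hγ⟩
    · rintro ⟨γ, hγ⟩
      exact ⟨γ, hγ⟩
  rw [h]
  exact measurable_drivingPath κ measurableSet_snd_image_generatedPairs

/-- **The SLE_κ trace is measurable, marginal by marginal, for every `κ`** (no trace theorem
needed): on the measurable generation event it is the measurable trace functional of the driving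
path (`Loewner.exists_measurable_eq_trace`, the Bernstein-driver approximation of the tip limit of
Rohde–Schramm (2005), §3 p. 896), and off it the junk constant `W 0 = 0`. Strengthens
`aemeasurable_sleTrace_holds`. [cite: RohdeSchramm2005, §3 p. 896] -/
@[fun_prop]
theorem measurable_sleTrace (t : ℝ≥0) : Measurable fun ω ↦ sleTrace κ ω t := by
  classical
  obtain ⟨T, hTm, hT⟩ := Loewner.exists_measurable_eq_trace
  have hS := measurableSet_setOf_exists_isGeneratedByCurve κ
  have heq : (fun ω ↦ sleTrace κ ω t) = fun ω ↦
      if ω ∈ {ω : ℝ≥0 → ℝ | ∃ γ, Loewner.IsGeneratedByCurve (sleDriving κ ω) γ} then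
        T (sleDriving κ ω) t else 0 := by
    funext ω
    split_ifs with hω
    · rw [sleTrace, ← hT _ (continuous_sleDriving κ ω) hω]
    · have hω' : ¬ ∃ γ, Loewner.IsGeneratedByCurve (sleDriving κ ω) γ := hω
      simp [sleTrace, Loewner.trace, dif_neg hω']
  rw [heq]
  exact Measurable.ite hS ((measurable_pi_apply t).comp (hTm.comp (measurable_sleDriving_pi κ)))
    measurable_const

/-- The SLE_κ trace, as a random element of the path space `ℝ≥0 → ℂ` (product σ-algebra), is
measurable, for every `κ`. Strengthens `aemeasurable_sleTrace_pi`. [folklore] -/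
@[fun_prop]
theorem measurable_sleTrace_pi : Measurable fun ω ↦ sleTrace κ ω :=
  measurable_pi_lambda _ (measurable_sleTrace κ)

/-- **The SLE_κ trace is a random element of `C([0, ∞), ℂ)`**: the bundled continuous curve
`ω ↦ γ(ω)` (the trace is continuous for every sample point, `continuous_sleTrace`) is Borel
measurable for the compact-open topology, for every `κ`, since its marginals are measurable
(`measurable_sleTrace`) and the Borel σ-algebra of path space is generated by the evaluations
(`Process.measurable_continuousMap_of_eval`). Billingsley (1999), §7. [cite: Billingsley1999, §7] -/
@[fun_prop]
theorem measurable_sleTracePath :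
    Measurable fun ω ↦ (⟨sleTrace κ ω, continuous_sleTrace κ ω⟩ : C(ℝ≥0, ℂ)) :=
  Process.measurable_continuousMap_of_eval fun t ↦ measurable_sleTrace κ t

end Measurable

/-! ### Convergence of the driving paths `√κₙ B → √κ B` -/

section Driving

variable {u : ℕ → ℝ≥0} {κ : ℝ≥0}

/-- **If `κₙ → κ` then `√κₙ B(ω) → √κ B(ω)` in `C([0, ∞), ℝ)`** (locally uniformly), for every
sample point: the driving path is `√κ • B(ω)` and scalar multiplication on path space is
continuous. Ambrosio–Miller (2022), §6 (the driving functions of the approximating SLE_κ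
converge to `√8 B`). [folklore] -/
theorem tendsto_drivingPath (hu : Tendsto u atTop (𝓝 κ)) (ω : ℝ≥0 → ℝ) :
    Tendsto (fun n ↦ drivingPath (u n) ω) atTop (𝓝 (drivingPath κ ω)) := by
  set b : C(ℝ≥0, ℝ) := ⟨fun t ↦ Process.brownian t ω, Process.continuous_brownian ω⟩ with hb
  have he : ∀ κ' : ℝ≥0, drivingPath κ' ω = Real.sqrt κ' • b := fun κ' ↦ by
    ext t
    simp [drivingPath_apply, sleDriving, hb]
  simp only [he]
  have h : Tendsto (fun n ↦ Real.sqrt (u n)) atTop (𝓝 (Real.sqrt κ)) :=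
    (Real.continuous_sqrt.tendsto _).comp (NNReal.tendsto_coe.2 hu)
  exact h.smul tendsto_const_nhds

end Driving

/-! ### The limit step: `HasSLETrace` is stable under tight limits in `κ` -/

section Limit

variable {u : ℕ → ℝ≥0} {κ : ℝ≥0}

/-- **Stability of trace existence under limits in `κ` (Ambrosio–Miller's limit step, chordal
capacity form).** Let `κₙ → κ` in `[0, ∞)`. If each SLE_{κₙ} is almost surely generated by a
curve and the laws of the SLE_{κₙ} traces `γ^{κₙ} ∈ C([0, ∞), ℂ)` (capacity parametrisation,
canonical coupling through the same Brownian motion) form a tight family, then SLE_κ is almost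
surely generated by a curve. Proof: the pairs `(γ^{κₙ}, √κₙ B)` satisfy the hypotheses of the
[LSW04] p. 981 limit argument `hasSLETrace_of_tendstoInDistribution` — generated chains a.s.
(`ae_isGeneratedByCurve_sleTrace`), tight curve laws, and `√κₙ B → √κ B` in distribution
(surely, `tendsto_drivingPath`, hence in law, Mathlib `tendstoInDistribution_of_ae_tendsto`) — whose conclusion is `HasSLETrace κ` (Prokhorov, the
closed set of generated pairs = chordal Lemma 3.14, portmanteau, Lusin–Souslin). With `κₙ ↑ 8`
this is the structure of Ambrosio–Miller (2022), proof of Thm. 1.2 from Thm. 1.1 (§6: "take a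
subsequential limit as `κ ↑ 8` … the resulting curve has a continuous Loewner driving function
which is given by `√8 B` … hence is SLE₈"). [cite: AmbrosioMiller2022, Thm 1.2 (§6)] -/
theorem hasSLETrace_of_tendsto_of_isTightMeasureSet (hu : Tendsto u atTop (𝓝 κ))
    (hgen : ∀ n, HasSLETrace (u n))
    (htight : IsTightMeasureSet
      (Set.range fun n ↦ Process.preWienerMeasure.map
        fun ω ↦ (⟨sleTrace (u n) ω, continuous_sleTrace (u n) ω⟩ : C(ℝ≥0, ℂ)))) :
    HasSLETrace κ := by
  haveI : Fact Process.isProjectiveLimit_preWienerMeasure :=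
    ⟨isProjectiveLimit_preWienerMeasure_holds'⟩
  -- sure convergence of the driving paths implies convergence in distribution
  have hlaw : TendstoInDistribution (fun n ↦ drivingPath (u n)) atTop (drivingPath κ)
      (fun _ ↦ Process.preWienerMeasure) Process.preWienerMeasure :=
    tendstoInDistribution_of_ae_tendsto (fun n ↦ (measurable_drivingPath (u n)).aemeasurable)
      (measurable_drivingPath κ).aemeasurable (ae_of_all _ fun ω ↦ tendsto_drivingPath hu ω)
  refine hasSLETrace_of_tendstoInDistribution (P := fun _ ↦ Process.preWienerMeasure)
    (Γ := fun n ω ↦ (⟨sleTrace (u n) ω, continuous_sleTrace (u n) ω⟩ : C(ℝ≥0, ℂ)))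
    (Ξ := fun n ↦ drivingPath (u n))
    (fun n ↦ (measurable_sleTracePath (u n)).aemeasurable) (fun n ↦ ?_) htight hlaw
  filter_upwards [ae_isGeneratedByCurve_sleTrace (hgen n)] with ω hω
  simpa only [coe_drivingPath, ContinuousMap.coe_mk] using hω

/-- **Stability under limits in `κ`, modulus form.** Let `κₙ → κ`, each SLE_{κₙ} a.s. generated
by a curve, and assume a uniform modulus-of-continuity bound of [LSW04] Prop. 4.5 shape for the
traces: for all `t, ε > 0` there is `δ > 0` with, eventually in `n`,
`P[∃ s, s' ≤ t, |s - s'| ≤ δ, |γ^{κₙ}(s) - γ^{κₙ}(s')| ≥ ε] < ε`. Then SLE_κ is a.s. generated by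
a curve: the bound gives tightness of the trace laws (Arzelà–Ascoli,
`isTightMeasureSet_of_prop45_shape`; the traces start at `0`), and
`hasSLETrace_of_tendsto_of_isTightMeasureSet` applies. Ambrosio–Miller (2022), Thms. 1.1–1.2;
[LSW04] p. 981. [cite: AmbrosioMiller2022, Thm 1.2 (§6)] -/
theorem hasSLETrace_of_tendsto_of_modulus (hu : Tendsto u atTop (𝓝 κ))
    (hgen : ∀ n, HasSLETrace (u n))
    (hmod : ∀ (t ε : ℝ), 0 < ε → ∃ δ : ℝ, 0 < δ ∧ ∀ᶠ n in atTop,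
      Process.preWienerMeasure {ω | ∃ s s' : ℝ≥0, (s : ℝ) ≤ t ∧ (s' : ℝ) ≤ t ∧ dist s s' ≤ δ ∧
        ε ≤ dist (sleTrace (u n) ω s) (sleTrace (u n) ω s')} < ENNReal.ofReal ε) :
    HasSLETrace κ := by
  haveI : Fact Process.isProjectiveLimit_preWienerMeasure :=
    ⟨isProjectiveLimit_preWienerMeasure_holds'⟩
  refine hasSLETrace_of_tendsto_of_isTightMeasureSet hu hgen
    (isTightMeasureSet_of_prop45_shape (P := fun _ ↦ Process.preWienerMeasure)
      (Γ := fun n ω ↦ (⟨sleTrace (u n) ω, continuous_sleTrace (u n) ω⟩ : C(ℝ≥0, ℂ)))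
      (fun n ↦ (measurable_sleTracePath (u n)).aemeasurable)
      (fun n ω ↦ by simp [sleTrace]) fun t ε hε ↦ ?_)
  obtain ⟨δ, hδ, hev⟩ := hmod t ε hε
  exact ⟨δ, hδ, by simpa only [ContinuousMap.coe_mk] using hev⟩

/-- **The set of `κ` with a trace is sequentially closed along tight sequences**: a reformulation
of `hasSLETrace_of_tendsto_of_isTightMeasureSet` for a sequence inside
`{κ | HasSLETrace κ}`. [cite: AmbrosioMiller2022, Thm 1.2 (§6)] -/
theorem hasSLETrace_of_mem_closure_of_isTightMeasureSet (hu : ∀ n, u n ∈ {κ | HasSLETrace κ})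
    (hlim : Tendsto u atTop (𝓝 κ))
    (htight : IsTightMeasureSet
      (Set.range fun n ↦ Process.preWienerMeasure.map
        fun ω ↦ (⟨sleTrace (u n) ω, continuous_sleTrace (u n) ω⟩ : C(ℝ≥0, ℂ)))) :
    κ ∈ {κ | HasSLETrace κ} :=
  hasSLETrace_of_tendsto_of_isTightMeasureSet hlim hu htight

/-! ### The case `κ = 8`: a second decomposition of `hasSLETrace_eight` -/

/-- A sequence `κₙ ≠ 8` tending to `8` (from below, `8 - 1/(n+1)`). [folklore] -/
theorem exists_tendsto_eight_ne :
    ∃ u : ℕ → ℝ≥0, Tendsto u atTop (𝓝 8) ∧ ∀ n, u n ≠ 8 := by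
  refine ⟨fun n ↦ 8 + 1 / ((n : ℝ≥0) + 1), ?_, fun n ↦ ?_⟩
  · have h' : Tendsto (fun n : ℕ ↦ (8 : ℝ) + 1 / ((n : ℝ) + 1)) atTop (𝓝 (8 + 0)) :=
      tendsto_const_nhds.add tendsto_one_div_add_atTop_nhds_zero_nat
    rw [add_zero] at h'
    refine NNReal.tendsto_coe.1 (h'.congr' (Eventually.of_forall fun n ↦ ?_))
    simp
  · have hpos : (0 : ℝ≥0) < 1 / ((n : ℝ≥0) + 1) := by positivity
    exact (lt_add_of_pos_right _ hpos).ne'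

/-- **`hasSLETrace_eight` from Rohde–Schramm's theorem and a uniform modulus estimate near
`κ = 8`** (the Ambrosio–Miller route to [LSW04] Thm. 4.7, chordal capacity form): if SLE_κ is
a.s. generated by a curve for `κ ≠ 8` (`hasSLETrace_of_ne_eight`, Rohde–Schramm (2005), Thm. 5.1;
hypothesis `hne`) and along some sequence `κₙ → 8`, `κₙ ≠ 8`, the capacity-parametrised SLE_{κₙ}
traces obey a uniform modulus-of-continuity bound of Prop. 4.5 shape, then SLE₈ is a.s. generated
by a curve. No uniform spanning tree enters. Ambrosio–Miller (2022), Thm. 1.2 from Thm. 1.1.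
[cite: AmbrosioMiller2022, Thm 1.2 (§6)] -/
theorem hasSLETrace_eight_of_ne_eight_of_modulus (hne : hasSLETrace_of_ne_eight)
    (hu : Tendsto u atTop (𝓝 8)) (hu8 : ∀ n, u n ≠ 8)
    (hmod : ∀ (t ε : ℝ), 0 < ε → ∃ δ : ℝ, 0 < δ ∧ ∀ᶠ n in atTop,
      Process.preWienerMeasure {ω | ∃ s s' : ℝ≥0, (s : ℝ) ≤ t ∧ (s' : ℝ) ≤ t ∧ dist s s' ≤ δ ∧
        ε ≤ dist (sleTrace (u n) ω s) (sleTrace (u n) ω s')} < ENNReal.ofReal ε) :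
    hasSLETrace_eight :=
  hasSLETrace_of_tendsto_of_modulus hu (fun n ↦ hne (hu8 n)) hmod

/-- **`hasSLETrace_eight` from Rohde–Schramm's theorem and tightness of the trace laws near
`κ = 8`** (tightness form of `hasSLETrace_eight_of_ne_eight_of_modulus`).
Ambrosio–Miller (2022), Thm. 1.2 from Thm. 1.1. [cite: AmbrosioMiller2022, Thm 1.2 (§6)] -/
theorem hasSLETrace_eight_of_ne_eight_of_isTightMeasureSet (hne : hasSLETrace_of_ne_eight)
    (hu : Tendsto u atTop (𝓝 8)) (hu8 : ∀ n, u n ≠ 8)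
    (htight : IsTightMeasureSet
      (Set.range fun n ↦ Process.preWienerMeasure.map
        fun ω ↦ (⟨sleTrace (u n) ω, continuous_sleTrace (u n) ω⟩ : C(ℝ≥0, ℂ)))) :
    hasSLETrace_eight :=
  hasSLETrace_of_tendsto_of_isTightMeasureSet hu (fun n ↦ hne (hu8 n)) htight

/-- **All of `HasSLETrace` from Rohde–Schramm's theorem and one tight sequence at `8`**: given
`hasSLETrace_of_ne_eight` and tightness of the SLE_{κₙ} trace laws along one sequence
`κₙ → 8`, `κₙ ≠ 8`, SLE_κ is a.s. generated by a curve for every `κ : ℝ≥0` (`κ = 8` by the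
limit step, `κ ≠ 8` by the hypothesis). Ambrosio–Miller (2022), Thm. 1.2; Rohde–Schramm (2005),
Thm. 5.1. [cite: AmbrosioMiller2022, Thm 1.2 (§6)] -/
theorem hasSLETrace_of_ne_eight_of_isTightMeasureSet (hne : hasSLETrace_of_ne_eight)
    (hu : Tendsto u atTop (𝓝 8)) (hu8 : ∀ n, u n ≠ 8)
    (htight : IsTightMeasureSet
      (Set.range fun n ↦ Process.preWienerMeasure.map
        fun ω ↦ (⟨sleTrace (u n) ω, continuous_sleTrace (u n) ω⟩ : C(ℝ≥0, ℂ)))) (κ : ℝ≥0) :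
    HasSLETrace κ :=
  hasSLETrace (hasSLETrace_eight_of_ne_eight_of_isTightMeasureSet hne hu hu8 htight) hne κ

end Limit

end Literature.Probability.RandomPlanarGeometry
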